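import Mathlib
import Literature.Probability.LatticeModels.GKSInequalities
import Literature.LinearAlgebra.Matrix.InverseMMatrixProofs
import Summits.CriticalPhenomena.Ising3DConformalLimit.Theses.PrecisionLaplacian
import Summits.CriticalPhenomena.Ising3DConformalLimit.Theorems.PrecisionLaplacianInverseMFerromagnetImDeg3OfNonadj
import HarnessLib

/-!
# Crux `PrecisionLaplacian.InverseMFerromagnet` (stmt-CriticalPhenomena-4798), line `Sketch` —
# stub `helper_db_of_im` (core D, dividend D1: IM self-improves to the dressed Bethe edge bound)

THEOREM-ONLY file (no definitions).  Let `Σ = (⟨σ_pσ_q⟩)_{p,q}` be the spin second-moment matrix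
of the zero-field pair ferromagnet `gksExpect univ K C` on `Fin n` (`K ≥ 0`, `|C i| = 2`), `x ≠ y`,
`κ = ∑_{i : C i = {x,y}} K_i` the total coupling on the pair, `t = tanh κ`, `G = ⟨σ_xσ_y⟩`.
CONDITIONALLY on the crux IM (`(Σ⁻¹)_pq ≤ 0` off the diagonal, for EVERY such system) we prove
`(Σ⁻¹)_xy ≤ −t/(1 + t² − 2tG)`.

Proof (one subdivision).  New system on `Fin (n+1)` (old sites `castSucc p`, fresh `w = last n`)
with bonds `Fin (m+2)`: the old bonds keep their sites, those equal to `{x,y}` get coupling `0`,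
and two new bonds `{w,x'}`, `{w,y'}` carry `J ≥ 0` with `cosh 2J = e^{2κ}` (`c4_exists_coupling`).
Summing out `σ_w` (`∑_τ e^{Jτ(u+v)} = 2e^{κ}e^{κuv}`, `c4_two_site_sum`) shows that the old spins
keep their law (`db_gksSum_old`: `Σ` is the principal submatrix of the new matrix `Σ*` on the old
sites) and `⟨σ_wσ_q⟩* = α(⟨σ_xσ_q⟩ + ⟨σ_yσ_q⟩)`, `α = ½ tanh 2J` (`db_gksSum_fresh`).  Hence
`v = e_w − αe_{x'} − αe_{y'}` has `vᵀΣ* = V e_wᵀ`, `V = 1 − 2α²(1+G) > 0`, row `w` of `Σ*⁻¹` is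
`v/V`, and one-index elimination (DMS 2014, Lemma 2.32, eq. (2.6) = `inv_submatrix_erase_one`)
gives `(Σ⁻¹)_xy = (Σ*⁻¹)_{x'y'} − α²/V` (`db_schur_row`).  IM for the new system gives
`(Σ*⁻¹)_{x'y'} ≤ 0`, and `α² = t/(1+t)²` turns `α²/V` into `t/(1 + t² − 2tG)` (`db_final_algebra`).
-/

namespace Summit.CriticalPhenomena.Ising3DConformalLimit.Cruxes.InverseMFerromagnet.PartialCovarianceLadder

open Literature.Probability.LatticeModels Finset Matrix
open Summit.CriticalPhenomena.Ising3DConformalLimit.Theses.PrecisionLaplacian (InverseMFerromagnet)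

/-! ## Scalar identities -/

/-- Summing the fresh spin `τ = ±1`: `∑_τ e^{Jτ(u+v)} = 2e^{κ} e^{κuv}` when `cosh 2J = e^{2κ}`
(`c4_two_site_sum`). [folklore] -/
theorem db_sum_tau_one {κ J u v : ℝ}
    (hJ : Real.exp (2 * J) + Real.exp (-(2 * J)) = 2 * Real.exp (2 * κ))
    (hu : u = 1 ∨ u = -1) (hv : v = 1 ∨ v = -1) :
    ∑ τ : ℤˣ, Real.exp (J * (((τ : ℤ)) : ℝ) * (u + v))
      = 2 * Real.exp κ * Real.exp (κ * (u * v)) := by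
  rw [UnitsInt.univ, Finset.sum_pair (by decide : (1 : ℤˣ) ≠ -1)]
  simp only [Units.val_one, Units.val_neg, Int.cast_one, Int.cast_neg, mul_one, mul_neg_one,
    neg_mul]
  exact c4_two_site_sum hJ hu hv

/-- Summing the fresh spin against itself: `∑_τ τ e^{Jτ(u+v)} = α (u+v) ∑_τ e^{Jτ(u+v)}` on
`u, v = ±1`, `α = (e^{2J} − e^{−2J})/(2(e^{2J} + e^{−2J})) = ½ tanh 2J`. [folklore] -/
theorem db_sum_tau_spin {J α : ℝ}
    (hα : α = (Real.exp (2 * J) - Real.exp (-(2 * J))) / (2 * (Real.exp (2 * J) + Real.exp (-(2 * J)))))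
    {u v : ℝ} (hu : u = 1 ∨ u = -1) (hv : v = 1 ∨ v = -1) :
    ∑ τ : ℤˣ, (((τ : ℤ)) : ℝ) * Real.exp (J * (((τ : ℤ)) : ℝ) * (u + v))
      = α * (u + v) * ∑ τ : ℤˣ, Real.exp (J * (((τ : ℤ)) : ℝ) * (u + v)) := by
  rw [hα, UnitsInt.univ, Finset.sum_pair (by decide : (1 : ℤˣ) ≠ -1),
    Finset.sum_pair (by decide : (1 : ℤˣ) ≠ -1)]
  simp only [Units.val_one, Units.val_neg, Int.cast_one, Int.cast_neg, mul_one, mul_neg_one,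
    neg_mul, one_mul]
  rcases hu with rfl | rfl <;> rcases hv with rfl | rfl
  · rw [show J * (1 + 1) = 2 * J by ring]
    field_simp
    ring
  · simp
  · simp
  · rw [show J * (-1 + -1) = -(2 * J) by ring, neg_neg]
    field_simp
    ring

/-- `tanh κ = (d² − 1)/(d² + 1)` with `d = e^{κ}`. [folklore] -/
theorem db_tanh_eq (κ : ℝ) :
    Real.tanh κ = (Real.exp κ ^ 2 - 1) / (Real.exp κ ^ 2 + 1) := by
  have h1 : Real.exp κ * Real.exp (-κ) = 1 := by
    rw [← Real.exp_add, add_neg_cancel, Real.exp_zero]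
  rw [Real.tanh_eq_sinh_div_cosh, Real.sinh_eq, Real.cosh_eq]
  field_simp
  linear_combination (-(2 : ℝ) * Real.exp κ) * h1

/-- The final algebra of the dressed Bethe bound: with `a = e^{2J}`, `c = e^{-2J}` (`ac = 1`,
`a + c = 2d²`, `d = e^{κ} > 0`), `α = (a − c)/(2(a + c))` has `α² = (d⁴−1)/(4d⁴) = t/(1+t)²` for
`t = (d²−1)/(d²+1)`, whence `α²/V = t/(1 + t² − 2tG)` for `V = 1 − 2α²(1+G)` (both sides have
the factor `V` in the denominator, so no sign condition on `V` is needed). [folklore] -/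
theorem db_final_algebra {a c d α G S : ℝ} (hd : 0 < d) (hac : a * c = 1) (hJ : a + c = 2 * d ^ 2)
    (hα : α = (a - c) / (2 * (a + c))) (hS : S ≤ 0) :
    S - α ^ 2 / (1 - 2 * α ^ 2 * (1 + G))
      ≤ -((d ^ 2 - 1) / (d ^ 2 + 1))
          / (1 + ((d ^ 2 - 1) / (d ^ 2 + 1)) ^ 2 - 2 * ((d ^ 2 - 1) / (d ^ 2 + 1)) * G) := by
  have hα2 : α ^ 2 = (d ^ 4 - 1) / (4 * d ^ 4) := by
    have h1 : (a - c) ^ 2 = 4 * d ^ 4 - 4 := by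
      linear_combination (a + c + 2 * d ^ 2) * hJ - 4 * hac
    rw [hα, div_pow, h1, hJ]
    field_simp
    ring
  rw [hα2]
  have hX : (d ^ 2 - 1) / (d ^ 2 + 1)
        / (1 + ((d ^ 2 - 1) / (d ^ 2 + 1)) ^ 2 - 2 * ((d ^ 2 - 1) / (d ^ 2 + 1)) * G)
      = (d ^ 4 - 1) / (4 * d ^ 4) / (1 - 2 * ((d ^ 4 - 1) / (4 * d ^ 4)) * (1 + G)) := by
    rw [show 1 + ((d ^ 2 - 1) / (d ^ 2 + 1)) ^ 2 - 2 * ((d ^ 2 - 1) / (d ^ 2 + 1)) * G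
      = 4 * d ^ 4 * (1 - 2 * ((d ^ 4 - 1) / (4 * d ^ 4)) * (1 + G)) / (d ^ 2 + 1) ^ 2 by
        field_simp; ring]
    field_simp
    ring
  rw [neg_div, hX]
  linarith

/-! ## Linear algebra: the row of a degree-two site and one-index elimination -/

/-- **Row of a degree-two site and one-index Schur step.**  Let `A` be a positive definite real
matrix on `Fin (n+1)` with unit diagonal at `w = last n`, `x'`, `y'` (`x ≠ y` old sites) whose row
`w` satisfies `A_{wq'} = α (A_{x'q'} + A_{y'q'})` for every old `q`.  Then, with `G = A_{x'y'}`
and `V = 1 − 2α²(1+G)`: `V > 0` (row `w` of `A⁻¹` is `(e_w − αe_{x'} − αe_{y'})/V`), and the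
inverse of the principal submatrix on the old sites has `xy`-entry `A⁻¹_{x'y'} − α²/V`
(DMS 2014, Lemma 2.32, eq. (2.6) = `inv_submatrix_erase_one`). [folklore] -/
theorem db_schur_row {n : ℕ} (A : Matrix (Fin (n + 1)) (Fin (n + 1)) ℝ) (hA : A.PosDef)
    (x y : Fin n) (hxy : x ≠ y) (α G : ℝ)
    (hrow : ∀ q : Fin n, A (Fin.last n) q.castSucc
      = α * (A x.castSucc q.castSucc + A y.castSucc q.castSucc))
    (hww : A (Fin.last n) (Fin.last n) = 1) (hxx : A x.castSucc x.castSucc = 1)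
    (hyy : A y.castSucc y.castSucc = 1) (hG : A x.castSucc y.castSucc = G) :
    0 < 1 - 2 * α ^ 2 * (1 + G) ∧
      (A.submatrix Fin.castSucc Fin.castSucc)⁻¹ x y
        = A⁻¹ x.castSucc y.castSucc - α ^ 2 / (1 - 2 * α ^ 2 * (1 + G)) := by
  have hsA : ∀ p q, A p q = A q p := fun p q => by simpa using hA.isHermitian.apply q p
  have hwx : Fin.last n ≠ x.castSucc := (Fin.castSucc_lt_last x).ne'
  have hwy : Fin.last n ≠ y.castSucc := (Fin.castSucc_lt_last y).ne'
  have hxy' : x.castSucc ≠ y.castSucc := fun h => hxy (Fin.castSucc_injective _ h)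
  have hdet : IsUnit A.det := (Matrix.isUnit_iff_isUnit_det A).mp hA.isUnit
  -- the vector `v = e_w − α e_{x'} − α e_{y'}` satisfies `vᵀ A = V e_wᵀ`, so `v = V · A⁻¹_{w,·}`
  obtain ⟨v, hv⟩ : ∃ v : Fin (n + 1) → ℝ, v = Pi.single (Fin.last n) 1
      - α • (Pi.single x.castSucc 1 + Pi.single y.castSucc 1) := ⟨_, rfl⟩
  have hvA : ∀ q, (v ᵥ* A) q = A (Fin.last n) q - α * (A x.castSucc q + A y.castSucc q) := by
    intro q
    simp [hv, Matrix.sub_vecMul, Matrix.smul_vecMul, Matrix.add_vecMul, Matrix.row_apply,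
      mul_add]
  have hvec : v ᵥ* A = Pi.single (Fin.last n) (1 - 2 * α ^ 2 * (1 + G)) := by
    funext q
    induction q using Fin.lastCases with
    | last =>
      rw [Pi.single_eq_same, hvA, hww, hsA x.castSucc (Fin.last n), hrow x, hxx,
        hsA y.castSucc (Fin.last n), hrow y, hyy, hG, hsA y.castSucc x.castSucc, hG]
      ring
    | cast q => rw [Pi.single_eq_of_ne (Fin.castSucc_lt_last q).ne, hvA, hrow]; ring
  have hvq : ∀ q, v q = (1 - 2 * α ^ 2 * (1 + G)) * A⁻¹ (Fin.last n) q := by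
    have h : v = (1 - 2 * α ^ 2 * (1 + G)) • A⁻¹ (Fin.last n) := by
      calc v = (v ᵥ* A) ᵥ* A⁻¹ := by
            rw [Matrix.vecMul_vecMul, Matrix.mul_nonsing_inv A hdet, Matrix.vecMul_one]
        _ = (1 - 2 * α ^ 2 * (1 + G)) • A⁻¹ (Fin.last n) := by
            rw [hvec, Matrix.single_vecMul]; rfl
    intro q
    simpa only [Pi.smul_apply, smul_eq_mul] using congrFun h q
  have hvw : v (Fin.last n) = 1 := by simp [hv, hwx, hwy]
  have hvx : v x.castSucc = -α := by simp [hv, hwx.symm, hxy']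
  have hvy : v y.castSucc = -α := by simp [hv, hwy.symm, hxy'.symm]
  -- `V > 0` since `V · A⁻¹_ww = v_w = 1` and `A⁻¹_ww > 0`
  have hθpos : 0 < A⁻¹ (Fin.last n) (Fin.last n) := hA.inv.diag_pos
  have h1 : (1 - 2 * α ^ 2 * (1 + G)) * A⁻¹ (Fin.last n) (Fin.last n) = 1 := by rw [← hvq, hvw]
  have hVpos : 0 < 1 - 2 * α ^ 2 * (1 + G) :=
    pos_of_mul_pos_left (h1.symm ▸ one_pos) hθpos.le
  refine ⟨hVpos, ?_⟩
  have hθ : A⁻¹ (Fin.last n) (Fin.last n) = 1 / (1 - 2 * α ^ 2 * (1 + G)) := by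
    rw [eq_div_iff hVpos.ne']; linarith [h1]
  have hwy' : A⁻¹ (Fin.last n) y.castSucc = -α / (1 - 2 * α ^ 2 * (1 + G)) := by
    rw [eq_div_iff hVpos.ne', mul_comm, ← hvq, hvy]
  have hx'w : A⁻¹ x.castSucc (Fin.last n) = -α / (1 - 2 * α ^ 2 * (1 + G)) := by
    have h : A⁻¹ x.castSucc (Fin.last n) = A⁻¹ (Fin.last n) x.castSucc := by
      simpa using hA.inv.isHermitian.apply (Fin.last n) x.castSucc
    rw [h, eq_div_iff hVpos.ne', mul_comm, ← hvq, hvx]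
  -- one-index elimination (DMS (2.6)), transported along `Fin n ≃ {i // i ≠ last n}`
  obtain ⟨-, hS⟩ := Literature.LinearAlgebra.Matrix.inv_submatrix_erase_one_holds (Fin (n + 1)) A
    (Fin.last n) hdet hθpos.ne'
  have hsub : A.submatrix Fin.castSucc Fin.castSucc
      = (A.submatrix (Subtype.val : {i : Fin (n + 1) // i ≠ Fin.last n} → Fin (n + 1))
          Subtype.val).submatrix (finSuccAboveEquiv (Fin.last n))
            (finSuccAboveEquiv (Fin.last n)) := by
    ext p q
    simp [Matrix.submatrix_apply, finSuccAboveEquiv_apply, Fin.succAbove_last]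
  have he : ∀ z : Fin n, ((finSuccAboveEquiv (Fin.last n) z : {i : Fin (n + 1) // i ≠ Fin.last n})
      : Fin (n + 1)) = z.castSucc := fun z => by simp [finSuccAboveEquiv_apply]
  rw [hsub, Matrix.inv_submatrix_equiv, Matrix.submatrix_apply, hS, he, he, hx'w, hwy', hθ]
  field_simp

/-! ## The once-subdivided system
Sites `Fin (n+1)` (old `castSucc p`, fresh `last n`), bonds `Fin (m+2)` (the old bonds keep their
sites, those equal to `{x,y}` get coupling `0`; two new bonds `{w,x'}`, `{w,y'}` of coupling `J`). -/

/-- Sums over configurations of `Fin (n+1)` split into the old spins and the fresh spin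
(`Fin.snocEquiv`). [folklore] -/
theorem db_sum_snoc {n : ℕ} (f : SpinConfig (Fin (n + 1)) → ℝ) :
    ∑ ω, f ω = ∑ σ : SpinConfig (Fin n), ∑ τ : ℤˣ, f (Fin.snoc σ τ) := by
  rw [← (Fin.snocEquiv fun _ => ℤˣ).sum_comp, Fintype.sum_prod_type, Finset.sum_comm]
  rfl

/-- The old Boltzmann weight with the `{x,y}`-bonds separated: `w(σ) = e^{R(σ)} e^{κσ_xσ_y}`,
`R(σ) = ∑_{C i ≠ {x,y}} K_i σ_{C_i}`, `κ = ∑_{C i = {x,y}} K_i`. [folklore] -/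
theorem db_gksWeight_old {n m : ℕ} (K : Fin m → ℝ) (C : Fin m → Finset (Fin n)) {x y : Fin n}
    (hxy : x ≠ y) (σ : SpinConfig (Fin n)) :
    gksWeight Finset.univ K C σ
      = Real.exp (∑ i, (if C i = {x, y} then 0 else K i) * spinProduct (C i) σ)
        * Real.exp ((∑ i ∈ Finset.univ.filter (fun i => C i = {x, y}), K i)
            * (spinAt x σ * spinAt y σ)) := by
  rw [gksWeight, gksHamiltonian, ← Real.exp_add]
  congr 1
  rw [Finset.sum_mul, Finset.sum_filter, ← Finset.sum_add_distrib]
  refine Finset.sum_congr rfl fun i _ => ?_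
  split_ifs with h
  · rw [h, spinProduct, Finset.prod_pair hxy]; ring
  · ring

section Subdivided

variable {n m : ℕ} {K : Fin m → ℝ} {C : Fin m → Finset (Fin n)} {x y : Fin n} {κ J α : ℝ}
  {Ks : Fin (m + 2) → ℝ} {Cs : Fin (m + 2) → Finset (Fin (n + 1))}
  (hK1 : ∀ i, Ks (Fin.castAdd 2 i) = if C i = {x, y} then 0 else K i)
  (hK2 : ∀ j : Fin 2, Ks (Fin.natAdd m j) = J)
  (hC1 : ∀ i, Cs (Fin.castAdd 2 i) = (C i).map Fin.castSuccEmb)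
  (hC20 : Cs (Fin.natAdd m 0) = {Fin.last n, x.castSucc})
  (hC21 : Cs (Fin.natAdd m 1) = {Fin.last n, y.castSucc})
include hK1 hK2 hC1 hC20 hC21

/-- The Boltzmann weight of the once-subdivided system at `(σ, τ)` (old spins `σ`, fresh spin
`τ`): `e^{R(σ)} · e^{Jτ(σ_x+σ_y)}`. [folklore] -/
theorem db_gksWeight_snoc (σ : SpinConfig (Fin n)) (τ : ℤˣ) :
    gksWeight Finset.univ Ks Cs (Fin.snoc σ τ : SpinConfig (Fin (n + 1)))
      = Real.exp (∑ i, (if C i = {x, y} then 0 else K i) * spinProduct (C i) σ)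
        * Real.exp (J * (((τ : ℤ)) : ℝ) * (spinAt x σ + spinAt y σ)) := by
  rw [gksWeight, gksHamiltonian, Fin.sum_univ_add, Fin.sum_univ_two, Real.exp_add]
  congr 1
  · congr 1
    refine Finset.sum_congr rfl fun i _ => ?_
    rw [hK1, hC1, spinProduct, spinProduct, Finset.prod_map]
    congr 1
    refine Finset.prod_congr rfl fun p _ => ?_
    simp [spinAt, Fin.castSuccEmb_apply]
  · rw [hK2 0, hK2 1, hC20, hC21, spinProduct, spinProduct,
      Finset.prod_pair (Fin.castSucc_lt_last x).ne', Finset.prod_pair (Fin.castSucc_lt_last y).ne']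
    simp only [spinAt, Fin.snoc_last, Fin.snoc_castSucc]
    congr 1
    ring

variable (hxy : x ≠ y) (hκ : ∑ i ∈ Finset.univ.filter (fun i => C i = {x, y}), K i = κ)
  (hJ : Real.exp (2 * J) + Real.exp (-(2 * J)) = 2 * Real.exp (2 * κ))
include hxy hκ hJ

/-- **Marginal identity, unnormalised.**  Summing out the fresh spin returns the old weight up to
`2e^{κ}`: `Z_new⟨F⟩_new = 2e^{κ} Z_old⟨F⟩_old` for every observable `F` of the old spins. [folklore] -/
theorem db_gksSum_old (F : SpinConfig (Fin n) → ℝ) :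
    gksSum Finset.univ Ks Cs (fun ω => F (fun p => ω p.castSucc))
      = 2 * Real.exp κ * gksSum Finset.univ K C F := by
  simp only [gksSum]
  rw [db_sum_snoc, Finset.mul_sum]
  refine Finset.sum_congr rfl fun σ _ => ?_
  have h1 : ∀ τ : ℤˣ, F (fun p => (Fin.snoc σ τ : SpinConfig (Fin (n + 1))) p.castSucc)
        * gksWeight Finset.univ Ks Cs (Fin.snoc σ τ)
      = F σ * Real.exp (∑ i, (if C i = {x, y} then 0 else K i) * spinProduct (C i) σ)
          * Real.exp (J * (((τ : ℤ)) : ℝ) * (spinAt x σ + spinAt y σ)) := by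
    intro τ
    rw [db_gksWeight_snoc hK1 hK2 hC1 hC20 hC21 σ τ]
    have hσ : (fun p => (Fin.snoc σ τ : SpinConfig (Fin (n + 1))) p.castSucc) = σ :=
      funext fun p => by simp
    rw [hσ]
    ring
  rw [Finset.sum_congr rfl fun τ _ => h1 τ, ← Finset.mul_sum,
    db_sum_tau_one hJ (spinAt_eq_one_or_eq_neg_one x σ) (spinAt_eq_one_or_eq_neg_one y σ),
    db_gksWeight_old K C hxy σ, hκ]
  ring

variable
  (hα : α = (Real.exp (2 * J) - Real.exp (-(2 * J))) / (2 * (Real.exp (2 * J) + Real.exp (-(2 * J)))))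
include hα

/-- **The fresh spin against the old spins, unnormalised.**  With `α = ½ tanh 2J`:
`Z_new⟨σ_w F⟩_new = 2e^{κ} α (Z_old⟨σ_x F⟩_old + Z_old⟨σ_y F⟩_old)` for every observable `F` of
the old spins (`E[σ_w | σ] = α(σ_x + σ_y)`). [folklore] -/
theorem db_gksSum_fresh (F : SpinConfig (Fin n) → ℝ) :
    gksSum Finset.univ Ks Cs (fun ω => spinAt (Fin.last n) ω * F (fun p => ω p.castSucc))
      = 2 * Real.exp κ * (α * (gksSum Finset.univ K C (fun σ => spinAt x σ * F σ)
          + gksSum Finset.univ K C (fun σ => spinAt y σ * F σ))) := by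
  simp only [gksSum]
  rw [← Finset.sum_add_distrib, Finset.mul_sum, Finset.mul_sum, db_sum_snoc]
  refine Finset.sum_congr rfl fun σ _ => ?_
  have h1 : ∀ τ : ℤˣ, spinAt (Fin.last n) (Fin.snoc σ τ : SpinConfig (Fin (n + 1)))
        * F (fun p => (Fin.snoc σ τ : SpinConfig (Fin (n + 1))) p.castSucc)
        * gksWeight Finset.univ Ks Cs (Fin.snoc σ τ)
      = F σ * Real.exp (∑ i, (if C i = {x, y} then 0 else K i) * spinProduct (C i) σ)
          * ((((τ : ℤ)) : ℝ) * Real.exp (J * (((τ : ℤ)) : ℝ) * (spinAt x σ + spinAt y σ))) := by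
    intro τ
    rw [db_gksWeight_snoc hK1 hK2 hC1 hC20 hC21 σ τ]
    have hσ : (fun p => (Fin.snoc σ τ : SpinConfig (Fin (n + 1))) p.castSucc) = σ :=
      funext fun p => by simp
    have hτ : spinAt (Fin.last n) (Fin.snoc σ τ : SpinConfig (Fin (n + 1))) = (((τ : ℤ)) : ℝ) := by
      simp [spinAt]
    rw [hσ, hτ]
    ring
  rw [Finset.sum_congr rfl fun τ _ => h1 τ, ← Finset.mul_sum,
    db_sum_tau_spin hα (spinAt_eq_one_or_eq_neg_one x σ) (spinAt_eq_one_or_eq_neg_one y σ),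
    db_sum_tau_one hJ (spinAt_eq_one_or_eq_neg_one x σ) (spinAt_eq_one_or_eq_neg_one y σ),
    db_gksWeight_old K C hxy σ, hκ]
  ring

end Subdivided

/-! ## The registered stub -/

/-- Registered stub `helper_db_of_im` (D1 of line `Sketch`, **the crux self-improves on edges**):
IF the crux `InverseMFerromagnet` holds, then for every zero-field pair ferromagnet and every
`x ≠ y` with total coupling `κ = ∑_{i : C i = {x,y}} K_i`, `t = tanh κ`, `G = ⟨σ_xσ_y⟩`:
`(Σ⁻¹)_xy ≤ −t/(1 + t² − 2tG)` (the dressed Bethe bound; for a non-adjacent pair it is IM).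
One subdivision `x – w – y` (`cosh 2J = e^{2κ}`), the explicit row of `w`, one-index elimination
and IM for the new system; see the module docstring.  CONDITIONAL on the crux by design.
[folklore] -/
theorem helper_db_of_im : InverseMFerromagnet →
    ∀ (n m : ℕ) (K : Fin m → ℝ) (C : Fin m → Finset (Fin n)), (∀ i, 0 ≤ K i) → (∀ i, (C i).card = 2) →
      ∀ x y : Fin n, x ≠ y →
        (Matrix.of fun p q : Fin n => gksExpect Finset.univ K C (fun ω => spinAt p ω * spinAt q ω))⁻¹ x y ≤
          -(Real.tanh (∑ i ∈ Finset.univ.filter (fun i => C i = {x, y}), K i)) /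
            (1 + Real.tanh (∑ i ∈ Finset.univ.filter (fun i => C i = {x, y}), K i) ^ 2
              - 2 * Real.tanh (∑ i ∈ Finset.univ.filter (fun i => C i = {x, y}), K i)
                * gksExpect Finset.univ K C (fun ω => spinAt x ω * spinAt y ω)) := by
  intro hIM n m K C hK hC x y hxy
  -- the total coupling `κ ≥ 0` on `{x, y}`; `J ≥ 0` with `cosh 2J = e^{2κ}`; `α = ½ tanh 2J`
  obtain ⟨κ, hκ⟩ : ∃ κ : ℝ, ∑ i ∈ Finset.univ.filter (fun i => C i = {x, y}), K i = κ := ⟨_, rfl⟩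
  have hκ0 : 0 ≤ κ := hκ ▸ Finset.sum_nonneg fun i _ => hK i
  obtain ⟨J, hJ0, hJ⟩ := c4_exists_coupling hκ0
  obtain ⟨α, hα⟩ : ∃ α : ℝ, α = (Real.exp (2 * J) - Real.exp (-(2 * J)))
      / (2 * (Real.exp (2 * J) + Real.exp (-(2 * J)))) := ⟨_, rfl⟩
  rw [hκ]
  -- the once-subdivided system `(Ks, Cs)`: `Fin (n+1)` sites, `Fin (m+2)` bonds, `K ≥ 0`, pairs
  have hxy' : x.castSucc ≠ y.castSucc := fun h => hxy (Fin.castSucc_injective _ h)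
  obtain ⟨Ks, hK1, hK2⟩ : ∃ Ks : Fin (m + 2) → ℝ,
      (∀ i, Ks (Fin.castAdd 2 i) = if C i = {x, y} then 0 else K i) ∧
        ∀ j : Fin 2, Ks (Fin.natAdd m j) = J :=
    ⟨Fin.append (fun i => if C i = {x, y} then 0 else K i) (fun _ => J),
      fun i => Fin.append_left _ _ i, fun j => Fin.append_right _ _ j⟩
  obtain ⟨Cs, hC1, hC20, hC21⟩ : ∃ Cs : Fin (m + 2) → Finset (Fin (n + 1)),
      (∀ i, Cs (Fin.castAdd 2 i) = (C i).map Fin.castSuccEmb) ∧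
        Cs (Fin.natAdd m 0) = {Fin.last n, x.castSucc} ∧
          Cs (Fin.natAdd m 1) = {Fin.last n, y.castSucc} :=
    ⟨Fin.append (fun i => (C i).map Fin.castSuccEmb)
        ![{Fin.last n, x.castSucc}, {Fin.last n, y.castSucc}],
      fun i => Fin.append_left _ _ i, Fin.append_right _ _ 0, Fin.append_right _ _ 1⟩
  have hKs0 : ∀ j, 0 ≤ Ks j := fun j =>
    Fin.addCases (fun i => by rw [hK1]; split_ifs; exacts [le_rfl, hK i])
      (fun i => by rw [hK2]; exact hJ0) j
  have hCs2 : ∀ j, (Cs j).card = 2 := fun j => by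
    refine Fin.addCases (fun i => ?_) (Fin.forall_fin_two.2 ⟨?_, ?_⟩) j
    · rw [hC1, Finset.card_map]; exact hC i
    · rw [hC20]; exact Finset.card_pair (Fin.castSucc_lt_last x).ne'
    · rw [hC21]; exact Finset.card_pair (Fin.castSucc_lt_last y).ne'
  -- its second-moment matrix `A = Σ*`: positive definite, and IM applies at the pair `(x', y')`
  obtain ⟨A, hA⟩ : ∃ A : Matrix (Fin (n + 1)) (Fin (n + 1)) ℝ,
      A = Matrix.of (fun p q : Fin (n + 1) =>
        gksExpect Finset.univ Ks Cs (fun ω => spinAt p ω * spinAt q ω)) := ⟨_, rfl⟩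
  have hPD : A.PosDef := pcov_posDef_of_eq hA
  have hS : A⁻¹ x.castSucc y.castSucc ≤ 0 := by
    rw [hA]
    exact hIM (n + 1) (m + 2) Ks Cs hKs0 hCs2 _ _ hxy'
  -- the entries of `A`: unit diagonal, old block `= Σ`, row `w` `= α (row x' + row y')`
  have hdiag : ∀ p, A p p = 1 := fun p => by
    simp only [hA, Matrix.of_apply, spinAt_mul_self, gksExpect]
    exact div_self (gksSum_one_pos _ _ _).ne'
  have hZ : gksSum Finset.univ Ks Cs (fun _ => (1 : ℝ))
      = 2 * Real.exp κ * gksSum Finset.univ K C (fun _ => 1) :=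
    db_gksSum_old hK1 hK2 hC1 hC20 hC21 hxy hκ hJ (fun _ => (1 : ℝ))
  have h2κ : (2 * Real.exp κ) ≠ 0 := by positivity
  have hold : ∀ p q : Fin n, A p.castSucc q.castSucc
      = gksExpect Finset.univ K C (fun σ => spinAt p σ * spinAt q σ) := fun p q => by
    have h2 : gksSum Finset.univ Ks Cs (fun ω => spinAt p.castSucc ω * spinAt q.castSucc ω)
        = 2 * Real.exp κ * gksSum Finset.univ K C (fun σ => spinAt p σ * spinAt q σ) :=
      db_gksSum_old hK1 hK2 hC1 hC20 hC21 hxy hκ hJ (fun σ => spinAt p σ * spinAt q σ)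
    simp only [hA, Matrix.of_apply, gksExpect]
    rw [hZ, h2]
    exact mul_div_mul_left _ _ h2κ
  have hrow : ∀ q : Fin n, A (Fin.last n) q.castSucc
      = α * (A x.castSucc q.castSucc + A y.castSucc q.castSucc) := fun q => by
    have h2 : gksSum Finset.univ Ks Cs (fun ω => spinAt (Fin.last n) ω * spinAt q.castSucc ω)
        = 2 * Real.exp κ * (α * (gksSum Finset.univ K C (fun σ => spinAt x σ * spinAt q σ)
            + gksSum Finset.univ K C (fun σ => spinAt y σ * spinAt q σ))) :=
      db_gksSum_fresh hK1 hK2 hC1 hC20 hC21 hxy hκ hJ hα (spinAt q)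
    have hZ0 : gksSum Finset.univ K C (fun _ => (1 : ℝ)) ≠ 0 := (gksSum_one_pos _ _ _).ne'
    rw [hold, hold, hA, Matrix.of_apply]
    simp only [gksExpect]
    rw [hZ, h2]
    field_simp
  have hsub : A.submatrix Fin.castSucc Fin.castSucc
      = Matrix.of (fun p q : Fin n =>
          gksExpect Finset.univ K C (fun ω => spinAt p ω * spinAt q ω)) := by
    ext p q
    rw [Matrix.submatrix_apply, Matrix.of_apply, hold]
  -- degree-two row of `w` and one-index elimination, then the algebra
  obtain ⟨-, hent⟩ := db_schur_row A hPD x y hxy α _ hrow (hdiag _) (hdiag _) (hdiag _)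
    (hold x y)
  rw [← hsub, hent, db_tanh_eq κ]
  have h2κ' : Real.exp (2 * κ) = Real.exp κ ^ 2 := by rw [sq, ← Real.exp_add, two_mul]
  refine db_final_algebra (Real.exp_pos κ) ?_ (h2κ' ▸ hJ) hα hS
  rw [← Real.exp_add, add_neg_cancel, Real.exp_zero]

end Summit.CriticalPhenomena.Ising3DConformalLimit.Cruxes.InverseMFerromagnet.PartialCovarianceLadder
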